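import Summits.ValiantsHypothesis.ValiantsHypothesis.Theses.LacunarySymmetroid

/-!
# Crux-strategist sketch for `MatrixDescartes` (stmt-ValiantsHypothesis-18050, route LacunarySymmetroid)

Typed census statements (all elaborate) and the cheap compositions, kernel-checked:

* `matrixDescartes_iff`       — read-back of the crux in `rootCount` currency (`Iff.rfl`).
* STRENGTHEN: `MatrixDescartesQP` (quasi-polynomial rule, the consensus repaired target) and
  `MatrixDescartesPoly` (polynomial rule / "dimension law" shape — FALSE on paper, see census §Strengthen);
  `matrixDescartesQP_of_poly`, `matrixDescartes_of_qp` PROVED (so `Poly ⇒ QP ⇒ MDR ⇒ VH`).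
* DECOMPOSITION: regime split `FewRowsMDR` / `ManyRowsMDR` with `matrixDescartes_of_regime` PROVED;
  the trivial monomial bound `DescartesPencil` (provable now, stated); the universal block lift
  `lift_det` PROVED (normal form of cards psd-lift / stable-normal-form).
* TRANSFER: `NormalFormMDR` (one symmetric matrix + signed diagonal monomial classes; the common normal
  form of cards psd-lift / stable-normal-form), `normalForm_of_matrixDescartes` PROVED, `LiftTransfer` stated.
* arithmetic: `eventually_mul_pow_le_two_pow` (polylog ≤ 2^L eventually).
-/

set_option linter.dupNamespace false
set_option linter.unusedVariables false

namespace Summit.ValiantsHypothesis.ValiantsHypothesis.Cruxes.MatrixDescartes.Strategy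

open Summit.ValiantsHypothesis.ValiantsHypothesis.Theses.LacunarySymmetroid
open scoped BigOperators Matrix
open Polynomial Filter Topology

/-- Number of distinct real roots of the determinant of the lacunary pencil `Σ_l X^(d l) • S l`. -/
noncomputable def rootCount {K m : ℕ} (d : Fin K → ℕ) (S : Fin K → Matrix (Fin m) (Fin m) ℝ) : ℕ :=
  ((∑ l, (X : ℝ[X]) ^ d l • (S l).map C).det).roots.toFinset.card

/-- Read-back: the crux in `rootCount` currency. -/
theorem matrixDescartes_iff :
    MatrixDescartes ↔ ∀ c q : ℕ, 0 < q → ∃ K₀ : ℕ, ∀ K m : ℕ, K₀ ≤ K →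
      m ≤ 2 ^ ((Nat.log 2 K + c) ^ c) → ∀ (d : Fin K → ℕ) (S : Fin K → Matrix (Fin m) (Fin m) ℝ),
        (∀ l, (S l).IsSymm) → rootCount d S ^ q ≤ 2 ^ (K * Nat.log 2 K) :=
  Iff.rfl

/-! ## Strengthen -/

/-- **S⁺ = QP-MDR.** Quasi-polynomial matrix Descartes rule: `Z ≤ 2^{a (log₂(m+K)+1)²}` for every
lacunary symmetric pencil, no regime, no `q`.  Saturated in shape by the Carstensen–Mulmuley–Shah bump
family (sibling `Cruxes/DerivedPencilRolle/Disproof.lean` §B: `2^{(1+o(1)) log²(m+K)}` roots). -/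
def MatrixDescartesQP : Prop :=
  ∃ a : ℕ, ∀ (K m : ℕ) (d : Fin K → ℕ) (S : Fin K → Matrix (Fin m) (Fin m) ℝ),
    (∀ l, (S l).IsSymm) → rootCount d S ≤ 2 ^ (a * (Nat.log 2 (m + K) + 1) ^ 2)

/-- **PolyMDR** (the "dimension law" / parameter-count shape): `Z ≤ (m+K+2)^a`.  FALSE on paper
(sibling §B), kept only to type the sandwich `Poly ⇒ QP ⇒ MDR`. -/
def MatrixDescartesPoly : Prop :=
  ∃ a : ℕ, ∀ (K m : ℕ) (d : Fin K → ℕ) (S : Fin K → Matrix (Fin m) (Fin m) ℝ),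
    (∀ l, (S l).IsSymm) → rootCount d S ≤ (m + K + 2) ^ a

/-- polynomial ≤ quasi-polynomial: `(x+2)^a ≤ 2^{2a (log₂ x + 1)²}`. -/
theorem pow_add_two_le (x a : ℕ) : (x + 2) ^ a ≤ 2 ^ (2 * a * (Nat.log 2 x + 1) ^ 2) := by
  set L := Nat.log 2 x with hL
  have hx : x < 2 ^ (L + 1) := Nat.lt_pow_succ_log_self (by norm_num) x
  have h1 : x + 2 ≤ 2 ^ (L + 2) := by
    have : 2 ≤ 2 ^ (L + 1) := by
      calc (2:ℕ) = 2 ^ 1 := by norm_num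
        _ ≤ 2 ^ (L + 1) := Nat.pow_le_pow_right (by norm_num) (by omega)
    calc x + 2 ≤ 2 ^ (L + 1) + 2 ^ (L + 1) := by omega
      _ = 2 ^ (L + 2) := by ring
  calc (x + 2) ^ a ≤ (2 ^ (L + 2)) ^ a := Nat.pow_le_pow_left h1 a
    _ = 2 ^ (a * (L + 2)) := by rw [← pow_mul, mul_comm]
    _ ≤ 2 ^ (2 * a * (L + 1) ^ 2) := by
        apply Nat.pow_le_pow_right (by norm_num)
        have : L + 2 ≤ 2 * (L + 1) ^ 2 := by nlinarith
        calc a * (L + 2) ≤ a * (2 * (L + 1) ^ 2) := Nat.mul_le_mul_left a this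
          _ = 2 * a * (L + 1) ^ 2 := by ring

theorem matrixDescartesQP_of_poly (h : MatrixDescartesPoly) : MatrixDescartesQP := by
  obtain ⟨a, h⟩ := h
  refine ⟨2 * a, fun K m d S hS => (h K m d S hS).trans ?_⟩
  simpa [Nat.add_comm, Nat.add_assoc] using pow_add_two_le (m + K) a

/-- Eventually `b·(L+s)^e ≤ 2^L` (polynomial growth in `L` loses to `2^L`). [folklore] -/
theorem eventually_mul_pow_le_two_pow (b s e : ℕ) : ∃ L₀ : ℕ, ∀ L ≥ L₀, b * (L + s) ^ e ≤ 2 ^ L := by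
  have hB : (0 : ℝ) < (b : ℝ) * 2 ^ s + 1 := by positivity
  have hε : (0 : ℝ) < 1 / ((b : ℝ) * 2 ^ s + 1) := by positivity
  have h := (tendsto_pow_const_div_const_pow_of_one_lt e (one_lt_two : (1 : ℝ) < 2)).eventually
    (gt_mem_nhds hε)
  obtain ⟨N, hN⟩ := Filter.eventually_atTop.1 h
  refine ⟨N, fun L hL => ?_⟩
  have h1 := hN (L + s) (by omega)
  have h2p : (0 : ℝ) < (2 : ℝ) ^ (L + s) := by positivity
  rw [div_lt_iff₀ h2p] at h1
  -- h1 : ((L+s : ℕ) : ℝ) ^ e < 1 / (b 2^s + 1) * 2 ^ (L + s)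
  have h3 : ((b : ℝ) * 2 ^ s + 1) * (((L + s : ℕ) : ℝ) ^ e) < (2 : ℝ) ^ (L + s) := by
    have := mul_lt_mul_of_pos_left h1 hB
    calc ((b : ℝ) * 2 ^ s + 1) * (((L + s : ℕ) : ℝ) ^ e)
        < ((b : ℝ) * 2 ^ s + 1) * (1 / ((b : ℝ) * 2 ^ s + 1) * 2 ^ (L + s)) := this
      _ = (2 : ℝ) ^ (L + s) := by field_simp
  have h4 : ((b : ℝ) * 2 ^ s) * (((L + s : ℕ) : ℝ) ^ e) ≤ (2 : ℝ) ^ s * 2 ^ L := by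
    have hnonneg : (0 : ℝ) ≤ ((L + s : ℕ) : ℝ) ^ e := by positivity
    have : ((b : ℝ) * 2 ^ s) * (((L + s : ℕ) : ℝ) ^ e) ≤ ((b : ℝ) * 2 ^ s + 1) * (((L + s : ℕ) : ℝ) ^ e) :=
      by nlinarith
    have h' : (2 : ℝ) ^ (L + s) = 2 ^ s * 2 ^ L := by rw [pow_add, mul_comm]
    linarith
  have h5 : ((b : ℝ)) * (((L + s : ℕ) : ℝ) ^ e) ≤ 2 ^ L := by
    have h2s : (0 : ℝ) < (2 : ℝ) ^ s := by positivity
    have : (2 : ℝ) ^ s * ((b : ℝ) * (((L + s : ℕ) : ℝ) ^ e)) ≤ 2 ^ s * 2 ^ L := by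
      calc (2 : ℝ) ^ s * ((b : ℝ) * (((L + s : ℕ) : ℝ) ^ e))
          = ((b : ℝ) * 2 ^ s) * (((L + s : ℕ) : ℝ) ^ e) := by ring
        _ ≤ 2 ^ s * 2 ^ L := h4
    exact le_of_mul_le_mul_left this h2s
  exact_mod_cast h5

/-- `x^c + x ≤ x^{c+2}` for `x ≥ 2`. -/
theorem pow_add_self_le (x c : ℕ) (hx : 2 ≤ x) : x ^ c + x ≤ x ^ (c + 2) := by
  have h1 : 1 ≤ x ^ c := Nat.one_le_pow _ _ (by omega)
  have h2 : x ^ (c + 2) = x ^ c * (x * x) := by ring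
  have h3 : x ^ c ≤ x ^ c * x := Nat.le_mul_of_pos_right _ (by omega)
  have h4 : x ≤ x ^ c * x := Nat.le_mul_of_pos_left _ h1
  have h5 : x ^ c * x + x ^ c * x ≤ x ^ c * (x * x) := by
    have : x ^ c * x + x ^ c * x = x ^ c * (2 * x) := by ring
    rw [this]
    exact Nat.mul_le_mul_left _ (by nlinarith)
  rw [h2]
  omega

/-- **QP-MDR ⇒ MDR** (the crux is implied by its quasi-polynomial strengthening; pure arithmetic:
in the regime `m ≤ 2^{(log₂K+c)^c}` one has `q·a·(log₂(m+K)+1)² ≤ 2^{log₂K} ≤ K·log₂K` eventually). -/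
theorem matrixDescartes_of_qp (h : MatrixDescartesQP) : MatrixDescartes := by
  obtain ⟨a, ha⟩ := h
  intro c q hq
  obtain ⟨L₀, hL₀⟩ := eventually_mul_pow_le_two_pow (q * a) (c + 4) (2 * (c + 2))
  refine ⟨2 ^ max L₀ 1, fun K m hK hm d S hS => ?_⟩
  set L := Nat.log 2 K with hL
  have hK0 : K ≠ 0 := by
    have : 0 < 2 ^ max L₀ 1 := by positivity
    omega
  have hpow : 2 ^ L ≤ K := Nat.pow_log_le_self 2 hK0
  have hKlt : K < 2 ^ (L + 1) := Nat.lt_pow_succ_log_self one_lt_two K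
  have hLge : max L₀ 1 ≤ L := Nat.le_log_of_pow_le one_lt_two hK
  have hL1 : 1 ≤ L := le_of_max_le_right hLge
  have hLL : L₀ ≤ L := le_of_max_le_left hLge
  -- bound log₂(m+K)
  set A := (L + c) ^ c with hA
  have hmK : m + K < 2 ^ (A + L + 2) := by
    have h1 : m ≤ 2 ^ A := hm
    have h2 : 2 ^ A ≤ 2 ^ (A + L + 1) := Nat.pow_le_pow_right (by norm_num) (by omega)
    have h3 : 2 ^ (L + 1) ≤ 2 ^ (A + L + 1) := Nat.pow_le_pow_right (by norm_num) (by omega)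
    calc m + K < 2 ^ A + 2 ^ (L + 1) := by omega
      _ ≤ 2 ^ (A + L + 1) + 2 ^ (A + L + 1) := Nat.add_le_add h2 h3
      _ = 2 ^ (A + L + 2) := by ring
  have hmK0 : m + K ≠ 0 := by omega
  have hlog : Nat.log 2 (m + K) < A + L + 2 := Nat.log_lt_of_lt_pow hmK0 hmK
  set x := L + (c + 4) with hx
  have hx2 : 2 ≤ x := by omega
  have hAx : A ≤ x ^ c := by
    rw [hA]; exact Nat.pow_le_pow_left (by omega) c
  have hlog' : Nat.log 2 (m + K) + 1 ≤ x ^ (c + 2) := by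
    calc Nat.log 2 (m + K) + 1 ≤ A + L + 2 := hlog
      _ ≤ x ^ c + x := by omega
      _ ≤ x ^ (c + 2) := pow_add_self_le x c hx2
  have hsq : (Nat.log 2 (m + K) + 1) ^ 2 ≤ x ^ (2 * (c + 2)) := by
    calc (Nat.log 2 (m + K) + 1) ^ 2 ≤ (x ^ (c + 2)) ^ 2 := Nat.pow_le_pow_left hlog' 2
      _ = x ^ (2 * (c + 2)) := by rw [← pow_mul, mul_comm]
  have hmain : q * a * (Nat.log 2 (m + K) + 1) ^ 2 ≤ K * L := by
    calc q * a * (Nat.log 2 (m + K) + 1) ^ 2 ≤ q * a * x ^ (2 * (c + 2)) := Nat.mul_le_mul_left _ hsq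
      _ ≤ 2 ^ L := hL₀ L hLL
      _ ≤ K := hpow
      _ = K * 1 := (mul_one K).symm
      _ ≤ K * L := Nat.mul_le_mul_left K hL1
  have hZ := ha K m d S hS
  calc rootCount d S ^ q ≤ (2 ^ (a * (Nat.log 2 (m + K) + 1) ^ 2)) ^ q := Nat.pow_le_pow_left hZ q
    _ = 2 ^ (q * a * (Nat.log 2 (m + K) + 1) ^ 2) := by rw [← pow_mul]; ring_nf
    _ ≤ 2 ^ (K * L) := Nat.pow_le_pow_right (by norm_num) hmain

/-! ## Decomposition -/

/-- Trivial monomial ("Descartes") bound, provable now: the determinant has at most `C(m+K, m)`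
monomials (exponents `Σ k_l d_l`, `|k| = m`), hence at most `2·C(m+K,m)` distinct real roots
(Descartes on `(0,∞)` and `(−∞,0)`, plus `0`).  [support; tree lemma
`card_roots_toFinset_filter_pos_lt_card_support` does the positive half] -/
def DescartesPencil : Prop :=
  ∀ (K m : ℕ) (d : Fin K → ℕ) (S : Fin K → Matrix (Fin m) (Fin m) ℝ),
    rootCount d S ≤ 2 * (m + K).choose m

/-- Easy regime (few rows: `m ≤ K·log₂K`, where the monomial count is `2^{O(K log log K)} = 2^{o(K log K)}`),
the piece `DescartesPencil` settles by arithmetic. -/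
def FewRowsMDR : Prop :=
  ∀ c q : ℕ, 0 < q → ∃ K₀ : ℕ, ∀ K m : ℕ, K₀ ≤ K → m ≤ 2 ^ ((Nat.log 2 K + c) ^ c) → m ≤ K * Nat.log 2 K →
    ∀ (d : Fin K → ℕ) (S : Fin K → Matrix (Fin m) (Fin m) ℝ), (∀ l, (S l).IsSymm) →
      rootCount d S ^ q ≤ 2 ^ (K * Nat.log 2 K)

/-- Hard regime (many rows: `K·log₂K < m ≤ 2^{(log₂K+c)^c}`): this piece IS the crux on its hard regime
(the census explains why it is not filed as a sub-crux). -/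
def ManyRowsMDR : Prop :=
  ∀ c q : ℕ, 0 < q → ∃ K₀ : ℕ, ∀ K m : ℕ, K₀ ≤ K → m ≤ 2 ^ ((Nat.log 2 K + c) ^ c) → K * Nat.log 2 K < m →
    ∀ (d : Fin K → ℕ) (S : Fin K → Matrix (Fin m) (Fin m) ℝ), (∀ l, (S l).IsSymm) →
      rootCount d S ^ q ≤ 2 ^ (K * Nat.log 2 K)

/-- The regime split composes (kernel-checked glue of census §Decomposition D3). -/
theorem matrixDescartes_of_regime (h₁ : FewRowsMDR) (h₂ : ManyRowsMDR) : MatrixDescartes := by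
  intro c q hq
  obtain ⟨K₁, hK₁⟩ := h₁ c q hq
  obtain ⟨K₂, hK₂⟩ := h₂ c q hq
  refine ⟨max K₁ K₂, fun K m hK hm d S hS => ?_⟩
  rcases Nat.lt_or_ge (K * Nat.log 2 K) m with hlt | hle
  · exact hK₂ K m (le_of_max_le_right hK) hm hlt d S hS
  · exact hK₁ K m (le_of_max_le_left hK) hm hle d S hS

/-- MDR restricts to each regime (so the split loses nothing). -/
theorem manyRows_of_matrixDescartes (h : MatrixDescartes) : ManyRowsMDR := by
  intro c q hq
  obtain ⟨K₀, hK₀⟩ := h c q hq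
  exact ⟨K₀, fun K m hK hm _ d S hS => hK₀ K m hK hm d S hS⟩

/-! ## Transfer / normal form: the universal block lift

For `F(t) = Σ_l t^{d_l} S_l` write `S_l = W_l Σ_l W_lᵀ` (congruence diagonalisation, `Σ_l = diag(±1)`),
`W = [W_0 | … | W_{K-1}]`, `D(t) = Σ · ⊕_l t^{d_l} I`.  Then `F(t) = W D(t) Wᵀ` and the block matrix
`𝔐(t) = [[−D(t)⁻¹, Wᵀ], [W, 0]] = A − (D(t)⁻¹ ⊕ 0)`, `A = [[0, Wᵀ], [W, 0]]` CONSTANT symmetric, has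
`det 𝔐(t) = det(−D(t)⁻¹) · det F(t)`: same positive zeros.  So every lacunary symmetric determinant is,
up to a monomial, `det(A − diag(σ_i t^{ν_i}) ⊕ 0)` — the common normal form behind the crux ideas
psd-lift-loewner-descartes and stable-normal-form.  The determinant identity: -/
theorem lift_det {m R : ℕ} (Dinv : Matrix (Fin R) (Fin R) ℝ) [Invertible Dinv]
    (W : Matrix (Fin m) (Fin R) ℝ) :
    (Matrix.fromBlocks Dinv Wᵀ W 0).det = Dinv.det * (-(W * ⅟Dinv * Wᵀ)).det := by
  rw [Matrix.det_fromBlocks₁₁, zero_sub]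

/-- … and with `Dinv = −D⁻¹` (so `⅟Dinv = −D`) the Schur complement is `W D Wᵀ = F(t)` itself. -/
theorem lift_det' {m R : ℕ} (D : Matrix (Fin R) (Fin R) ℝ) [Invertible D]
    (W : Matrix (Fin m) (Fin R) ℝ) :
    (Matrix.fromBlocks (-⅟D) Wᵀ W 0).det = (-⅟D).det * (W * D * Wᵀ).det := by
  haveI : Invertible (-⅟D) := invertibleNeg (⅟D)
  rw [Matrix.det_fromBlocks₁₁, zero_sub]
  congr 2
  rw [invOf_neg, invOf_invOf]
  simp [Matrix.neg_mul, Matrix.mul_neg]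

/-- **C⁺ = normal-form crux** (census §Transfer T0 / §Decomposition D2): `MatrixDescartes` restricted to
pencils all of whose coefficients but one are DIAGONAL with entries in `{−1, 0, 1}` — i.e.
`det(X^e • A + Σ_l X^{d_l} • E_l)`, `A` arbitrary symmetric ("one symmetric matrix on a signed monomial
curve").  By the block lift (`lift_det'` + congruence diagonalisation `S_l = W_l Σ_l W_lᵀ`) every
lacunary symmetric pencil of format `(m, K)` has the same nonzero real zeros as a normal-form pencil of
format `(m(K+1), K+1)`, so `NormalFormMDR ⇔ MatrixDescartes`; the cards psd-lift-loewner-descartes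
and stable-normal-form are two presentations of this one normal form. -/
def NormalFormMDR : Prop :=
  ∀ c q : ℕ, 0 < q → ∃ K₀ : ℕ, ∀ K m : ℕ, K₀ ≤ K → m ≤ 2 ^ ((Nat.log 2 K + c) ^ c) →
    ∀ (d : Fin K → ℕ) (S : Fin K → Matrix (Fin m) (Fin m) ℝ), (∀ l, (S l).IsSymm) →
      (∃ l₀ : Fin K, ∀ l, l ≠ l₀ →
          ∃ σ : Fin m → ℝ, (∀ i, σ i = 1 ∨ σ i = 0 ∨ σ i = -1) ∧ S l = Matrix.diagonal σ) →
        rootCount d S ^ q ≤ 2 ^ (K * Nat.log 2 K)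

/-- the trivial direction -/
theorem normalForm_of_matrixDescartes (h : MatrixDescartes) : NormalFormMDR := by
  intro c q hq
  obtain ⟨K₀, hK₀⟩ := h c q hq
  exact ⟨K₀, fun K m hK hm d S hS _ => hK₀ K m hK hm d S hS⟩

/-- **Lift transfer** (support, provable now, M/L-sized in Lean: congruence diagonalisation of each
`S_l`, `lift_det'`, clearing the negative powers by `X^e`, and the regime bookkeeping
`m(K+1) ≤ 2^{(log₂(K+1)+c+2)^{c+2}}`; the `∀ q` slack absorbs the `K ↦ K+1` shift). -/
def LiftTransfer : Prop := NormalFormMDR → MatrixDescartes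

end Summit.ValiantsHypothesis.ValiantsHypothesis.Cruxes.MatrixDescartes.Strategy
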